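import Literature.Analysis.Asymptotics.LogPowerScale
import HarnessLib

/-!
# The log-power scale at `0⁺` along a sub-filter of `𝓝[>] 0`

Topic `Literature/Analysis/Asymptotics` (theorems only). This file transports the main statement
of `Literature.Analysis.Asymptotics.LogPowerScale` — linear independence of the *divergent*
monomials `s ^ a * (log s) ^ b` (`a < 0`, or `a = 0` and `0 < b`) modulo functions with a finite
limit at `0⁺` — from the full one-sided neighbourhood filter `𝓝[>] 0` to an arbitrary non-trivial
filter `l ≤ 𝓝[>] 0` (typically `𝓝[>] 0 ⊓ 𝓟 A` for a set `A` of full measure near `0`, which is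
what a.e.-statements about parametric integrals provide):

* `eq_zero_of_tendsto_sum_divergentMonomials_of_le` — if a finite real combination
  `∑ i ∈ S, w i * s ^ (a i) * (log s) ^ (b i)` of divergent monomials tends to a finite limit `d`
  along a non-trivial filter `l ≤ 𝓝[>] 0`, then `d = 0`;
* `eq_zero_of_tendsto_fintypeSum_divergentMonomials_of_le` — the same for a `Fintype`-indexed sum;
* `tendsto_nhds_unique_of_sub_sum_divergentMonomials_of_le` — uniqueness of finite log-power
  expansions modulo functions converging along `l`.

Proof: verbatim the dominant-monomial induction of `eq_zero_of_tendsto_sum_divergentMonomials`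
(strong induction on the index set; normalise by the inverse of the most divergent monomial, whose
total coefficient must vanish, and remove it); every comparison limit at `0⁺` restricts to `l` by
`Filter.Tendsto.mono_left`, and uniqueness of limits along `l` is where `l.NeBot` enters. The
dominant-exponent argument is Kaiser 2017, Lemma 4.6 / Prop. 4.7 (there over the field of real
Puiseux series).

## References

* T. Kaiser, *Lebesgue measure and integration theory on non-archimedean real closed fields with
  archimedean value group*, Proc. LMS 116 (2017), §4, Lemma 4.6, Prop. 4.7. [cite: Kaiser2017]
-/

noncomputable section

open Filter
open scoped Topology

namespace Literature.Analysis.Asymptotics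

/-- **Divergent log-power monomials form an asymptotic scale along every non-trivial
`l ≤ 𝓝[>] 0`.** If a finite real combination `∑ i ∈ S, w i * s ^ (a i) * (log s) ^ (b i)` of
monomials which are all *divergent* at `0⁺` (`a i < 0`, or `a i = 0` and `0 < b i`) tends to a
finite limit `d` along a non-trivial filter `l ≤ 𝓝[>] 0`, then `d = 0`.
Proof: strong induction on `S`; normalise by the dominant monomial (least `a`, then largest `b`),
whose total coefficient must therefore vanish, and remove it (cf. Kaiser 2017, Lemma 4.6 and
Prop. 4.7: the same dominant-exponent argument over the field of Puiseux series); the case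
`l = 𝓝[>] 0` is `eq_zero_of_tendsto_sum_divergentMonomials`.
[cite: Kaiser2017, Prop. 4.7] -/
theorem eq_zero_of_tendsto_sum_divergentMonomials_of_le {ι : Type*} {a : ι → ℝ} {b : ι → ℕ}
    {w : ι → ℝ} {d : ℝ} {l : Filter ℝ} [l.NeBot] (hl : l ≤ 𝓝[>] 0) :
    ∀ S : Finset ι, (∀ i ∈ S, a i < 0 ∨ (a i = 0 ∧ 0 < b i)) →
      Tendsto (fun s : ℝ => ∑ i ∈ S, w i * s ^ (a i) * Real.log s ^ (b i)) l (𝓝 d) →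
      d = 0 := by
  classical
  intro S
  induction S using Finset.strongInduction with
  | H S ih =>
    intro hab h
    rcases S.eq_empty_or_nonempty with rfl | hne
    · simp only [Finset.sum_empty] at h
      exact tendsto_nhds_unique h tendsto_const_nhds
    -- the dominant (most divergent) exponent pair `(a₀, b₀)`: least `a`, then largest `b`
    obtain ⟨a₀, b₀, ⟨i₀, hi₀S, hai₀, hbi₀⟩, hdom⟩ :
        ∃ a₀ : ℝ, ∃ b₀ : ℕ, (∃ i ∈ S, a i = a₀ ∧ b i = b₀) ∧
          ∀ i ∈ S, a₀ < a i ∨ (a i = a₀ ∧ b i ≤ b₀) := by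
      obtain ⟨i₁, hi₁, ha₁⟩ := S.exists_min_image a hne
      have hTne : (S.filter fun j => a j = a i₁).Nonempty :=
        ⟨i₁, Finset.mem_filter.mpr ⟨hi₁, rfl⟩⟩
      obtain ⟨i₂, hi₂, hb₂⟩ := (S.filter fun j => a j = a i₁).exists_max_image b hTne
      obtain ⟨hi₂S, ha₂⟩ := Finset.mem_filter.mp hi₂
      refine ⟨a i₁, b i₂, ⟨i₂, hi₂S, ha₂, rfl⟩, fun i hi => ?_⟩
      rcases (ha₁ i hi).lt_or_eq with hlt | heq
      · exact Or.inl hlt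
      · exact Or.inr ⟨heq.symm, hb₂ i (Finset.mem_filter.mpr ⟨hi, heq.symm⟩)⟩
    have hdiv₀ : a₀ < 0 ∨ (a₀ = 0 ∧ 0 < b₀) := by
      rw [← hai₀, ← hbi₀]; exact hab i₀ hi₀S
    -- the indices carrying the dominant monomial
    set J := S.filter fun j => a j = a₀ ∧ b j = b₀ with hJ_def
    have hJS : J ⊆ S := Finset.filter_subset _ _
    have hJne : J.Nonempty := ⟨i₀, Finset.mem_filter.mpr ⟨hi₀S, hai₀, hbi₀⟩⟩
    -- the normalising factor `u = 1 / (s ^ a₀ * (log s) ^ b₀)` tends to `0` (along `l`)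
    set u : ℝ → ℝ := fun s => s ^ (-a₀) * (Real.log s)⁻¹ ^ b₀ with hu_def
    have hu : Tendsto u l (𝓝 0) :=
      (tendsto_inv_divergentMonomial_nhdsGT_zero hdiv₀).mono_left hl
    -- eventually (along `l`) `0 < s < 1`, so that `log s ≠ 0`
    have hmem : ∀ᶠ s : ℝ in l, 0 < s ∧ s < 1 := hl (Ioo_mem_nhdsGT one_pos)
    have hrew : ∀ i, ∀ s : ℝ, 0 < s → u s * (s ^ (a i) * Real.log s ^ (b i)) =
        s ^ (a i - a₀) * Real.log s ^ (b i) * (Real.log s)⁻¹ ^ b₀ := by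
      intro i s hs
      simp only [hu_def]
      rw [sub_eq_neg_add, Real.rpow_add hs]
      ring
    -- limits (along `l`) of the normalised monomials: `1` on `J`, `0` off `J`
    set L : ι → ℝ := fun i => if a i = a₀ ∧ b i = b₀ then 1 else 0 with hL_def
    have hlim : ∀ i ∈ S,
        Tendsto (fun s => u s * (s ^ (a i) * Real.log s ^ (b i))) l (𝓝 (L i)) := by
      intro i hi
      by_cases hJi : a i = a₀ ∧ b i = b₀
      · -- dominant index: the normalised monomial is eventually `1`
        obtain ⟨hai, hbi⟩ := hJi
        have hL : L i = 1 := by simp [hL_def, hai, hbi]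
        rw [hL]
        have hev : ∀ᶠ s : ℝ in l, u s * (s ^ (a i) * Real.log s ^ (b i)) = 1 := by
          filter_upwards [hmem] with s hs
          have hlog : Real.log s ≠ 0 := (Real.log_neg hs.1 hs.2).ne
          rw [hrew i s hs.1, hai, hbi, sub_self, Real.rpow_zero, one_mul, ← mul_pow,
            mul_inv_cancel₀ hlog, one_pow]
        exact tendsto_const_nhds.congr' (hev.mono fun s hs => hs.symm)
      · have hL : L i = 0 := by simp [hL_def, hJi]
        rw [hL]
        rcases hdom i hi with hai | ⟨hai, hble⟩
        · -- strictly larger power of `s`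
          have key := ((tendsto_rpow_mul_log_pow_nhdsGT_zero (sub_pos.mpr hai) (b i)).mul
            (tendsto_inv_log_nhdsGT_zero.pow b₀)).mono_left hl
          rw [zero_mul] at key
          refine key.congr' ?_
          filter_upwards [hmem] with s hs
          rw [hrew i s hs.1]
        · -- same power of `s`, strictly smaller power of `log s`
          have hbi : b i < b₀ := lt_of_le_of_ne hble fun h => hJi ⟨hai, h⟩
          have key : Tendsto (fun s : ℝ => (Real.log s)⁻¹ ^ (b₀ - b i)) l (𝓝 0) := by
            simpa [zero_pow (Nat.sub_ne_zero_of_lt hbi)] using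
              (tendsto_inv_log_nhdsGT_zero.pow (b₀ - b i)).mono_left hl
          refine key.congr' ?_
          filter_upwards [hmem] with s hs
          have hlog : Real.log s ≠ 0 := (Real.log_neg hs.1 hs.2).ne
          rw [eq_comm, hrew i s hs.1, hai, sub_self, Real.rpow_zero, one_mul,
            ← pow_sub_mul_pow (Real.log s)⁻¹ hbi.le, mul_left_comm, ← mul_pow,
            mul_inv_cancel₀ hlog, one_pow, mul_one]
    -- hence `u * P → ∑ i ∈ S, w i * L i`, while also `u * P → 0 * d = 0` (along `l`)
    have hsum : Tendsto (fun s => u s * ∑ i ∈ S, w i * s ^ (a i) * Real.log s ^ (b i)) l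
        (𝓝 (∑ i ∈ S, w i * L i)) := by
      have := tendsto_finsetSum S fun i hi => (hlim i hi).const_mul (w i)
      refine this.congr fun s => ?_
      rw [Finset.mul_sum]
      exact Finset.sum_congr rfl fun i _ => by ring
    have hWJ : ∑ i ∈ J, w i = 0 := by
      have h0 : ∑ i ∈ S, w i * L i = 0 := by
        have := hu.mul h
        rw [zero_mul] at this
        exact tendsto_nhds_unique hsum this
      rw [hJ_def, Finset.sum_filter]
      simpa [hL_def, mul_ite] using h0
    -- remove the dominant monomial: the remaining sum is the same function
    have hsplit : ∀ s : ℝ, ∑ i ∈ S \ J, w i * s ^ (a i) * Real.log s ^ (b i) =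
        ∑ i ∈ S, w i * s ^ (a i) * Real.log s ^ (b i) := by
      intro s
      rw [← Finset.sum_sdiff hJS, left_eq_add]
      calc ∑ i ∈ J, w i * s ^ (a i) * Real.log s ^ (b i)
          = ∑ i ∈ J, w i * (s ^ a₀ * Real.log s ^ b₀) := by
            refine Finset.sum_congr rfl fun i hi => ?_
            obtain ⟨-, hai, hbi⟩ := Finset.mem_filter.mp hi
            rw [hai, hbi, mul_assoc]
        _ = 0 := by rw [← Finset.sum_mul, hWJ, zero_mul]
    exact ih (S \ J) (Finset.sdiff_ssubset hJS hJne) (fun i hi => hab i (Finset.sdiff_subset hi))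
      (h.congr fun s => (hsplit s).symm)

/-- `Fintype`-indexed form of `eq_zero_of_tendsto_sum_divergentMonomials_of_le`: if a finite real
combination `∑ i, w i * s ^ (a i) * (log s) ^ (b i)` of monomials divergent at `0⁺` tends to a
finite limit `d` along a non-trivial filter `l ≤ 𝓝[>] 0`, then `d = 0`.
[cite: Kaiser2017, Prop. 4.7] -/
theorem eq_zero_of_tendsto_fintypeSum_divergentMonomials_of_le {ι : Type*} [Fintype ι]
    {a : ι → ℝ} {b : ι → ℕ} {w : ι → ℝ} {d : ℝ} {l : Filter ℝ} [l.NeBot] (hl : l ≤ 𝓝[>] 0)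
    (hab : ∀ i, a i < 0 ∨ (a i = 0 ∧ 0 < b i))
    (h : Tendsto (fun s : ℝ => ∑ i, w i * s ^ (a i) * Real.log s ^ (b i)) l (𝓝 d)) :
    d = 0 :=
  eq_zero_of_tendsto_sum_divergentMonomials_of_le hl Finset.univ (fun i _ => hab i) h

/-- **Uniqueness of finite log-power expansions modulo functions converging along `l`**: if `f`
tends to `c` and `f - P` tends to `c'` along a non-trivial filter `l ≤ 𝓝[>] 0`, where `P` is a
finite combination of monomials divergent at `0⁺`, then `c = c'`.
[cite: Kaiser2017, Prop. 4.7] -/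
theorem tendsto_nhds_unique_of_sub_sum_divergentMonomials_of_le {ι : Type*} [Fintype ι]
    {a : ι → ℝ} {b : ι → ℕ} {w : ι → ℝ} {f : ℝ → ℝ} {c c' : ℝ} {l : Filter ℝ} [l.NeBot]
    (hl : l ≤ 𝓝[>] 0) (hab : ∀ i, a i < 0 ∨ (a i = 0 ∧ 0 < b i)) (hc : Tendsto f l (𝓝 c))
    (hc' : Tendsto (fun s : ℝ => f s - ∑ i, w i * s ^ (a i) * Real.log s ^ (b i)) l (𝓝 c')) :
    c = c' := by
  have key : Tendsto (fun s : ℝ => ∑ i, w i * s ^ (a i) * Real.log s ^ (b i)) l (𝓝 (c - c')) :=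
    (hc.sub hc').congr fun s => by ring
  have := eq_zero_of_tendsto_fintypeSum_divergentMonomials_of_le hl hab key
  linarith

end Literature.Analysis.Asymptotics
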